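import Literature.AlgebraicGeometry.Resolution.ResiduallyAlgebraicReduction
import Literature.AlgebraicGeometry.Resolution.ZariskiPatchingProperModelsWeakLU
import Summits.ResolutionOfSingularities.ResolutionOfSingularities.Theorems.SoloInformedRankOne
import HarnessLib

/-!
# Resolution in characteristic `p` = proper two-model patching ∧ the core `μ_p`-torsor step at
# rank-one, residually algebraic valuations ("generalised arcs")

Summit-side packaging of `Literature/…/ResiduallyAlgebraicReduction.lean` (enlarging the ground
field inside the valuation ring: relative local uniformization over `k` follows from relative
local uniformization over a finitely generated `k₁ ⊆ O` over which the residue field of `O` is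
algebraic) on top of `SoloInformedRankOne` (Novacoski–Spivakovsky's reduction to rank one,
Temkin in height one, Cossart–Piltant in dimension `≤ 3`, Cutkosky at Abhyankar places) and
Zariski–Piltant patching of proper models in weak-LU form:

* `zeroDimRankOneRelCoreSteps_of_resolutionInChar` — resolution in characteristic `p` implies
  the core model-form steps at the rank-one, residually algebraic valuation rings (unconditional);
* `resolutionInChar_iff_twoModelPatching_and_zeroDimRankOneRelCoreSteps` — **the split at
  generalised arcs**: granted `Temkin2013HeightLeOne` and `CossartPiltant2019LU3`,
  `ResolutionInChar p ↔ ProperModel.TwoModelPatching p ∧ (core model-form μ_p-torsor steps at the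
  valuation rings O of finitely generated extensions K/k, char k = p, with value group of rank
  one AND residue field algebraic over k)`; the local conjunct is spelled out in every statement;
  `resolutionOfSingularities_iff_twoModelPatching_and_zeroDimRankOneRelCoreSteps` — the same for
  the summit statement itself (all primes, universe `0`).

The valuations left in the local conjunct are exactly the `k`-trivial valuations
`v : K ↪ κ((t^Γ))` with `Γ ⊆ ℝ` and `κ/k` algebraic, of positive transcendence defect
(non-Abhyankar), evaluated on one `μ_p`-torsor `A₀[a]`, `a^p ∈ A₀`, over a prescribed regular
finitely generated `A₀ ⊆ O` with `trdeg_k Frac A₀ ≥ 4`.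
-/

noncomputable section

namespace Summit.ResolutionOfSingularities.ResolutionOfSingularities.Theorems

open CategoryTheory AlgebraicGeometry IsLocalRing
open Literature.AlgebraicGeometry Literature.AlgebraicGeometry.Resolution

universe u

/-- Resolution in characteristic `p` implies the core model-form torsor steps at the rank-one,
residually algebraic valuation rings of finitely generated extensions (unconditional). -/
theorem zeroDimRankOneRelCoreSteps_of_resolutionInChar {p : ℕ} [Fact p.Prime]
    (h : ResolutionInChar.{0} p) :
    ∀ (k K : Type) [Field k] [CharP k p] [Field K] [Algebra k K],
      (⊤ : IntermediateField k K).FG → ∀ O : ValuationSubring K,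
        Nonempty O.valuation.RankOne → (∀ c : k, algebraMap k K c ∈ O) →
          IsResiduallyAlgebraic k O → RelMuPTorsorCoreStepsAt p k O :=
  fun k K _ _ _ _ _ O _ hk _ => relCoreSteps_of_resolutionInChar h k K O hk

/-- **Core steps at rank-one residually algebraic valuation rings over `k` and its finitely
generated extensions + Temkin (height one) + Cossart–Piltant (dim ≤ 3) + proper two-model
patching over `k` ⇒ weak resolution over `k` in every dimension** (universe `0`). The local
hypothesis is quantified over all ground fields of characteristic `p` because the reduction
enlarges the ground field inside `O`. -/
theorem resolutionOverUpToDim_of_zeroDimRankOneRelCoreSteps_of_properPatching {p : ℕ}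
    [Fact p.Prime] (hT₁ : Temkin2013HeightLeOne.{0}) (hCP : CossartPiltant2019LU3.{0})
    (H : ∀ (k K : Type) [Field k] [CharP k p] [Field K] [Algebra k K],
      (⊤ : IntermediateField k K).FG → ∀ O : ValuationSubring K,
        Nonempty O.valuation.RankOne → (∀ c : k, algebraMap k K c ∈ O) →
          IsResiduallyAlgebraic k O → RelMuPTorsorCoreStepsAt p k O)
    {k : Type} [Field k] [CharP k p]
    (hZ : ∀ (K : Type) [Field K] [Algebra k K] [Algebra.EssFiniteType k K],
      ∀ M₁ M₂ : ProperModel k K,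
        ∃ (N : ProperModel k K) (φ₁ : N.Hom M₁) (φ₂ : N.Hom M₂), φ₁.RegLe ∧ φ₂.RegLe)
    (d : ℕ) : ResolutionOverUpToDim k d :=
  resolutionOverUpToDim_of_properPatching_of_lu hZ
    (fun K _ _ hfg O hO => isLocallyUniformizable_of_relLocalUniformization hfg O hO
      (relLocalUniformization_of_rankOne_residuallyAlgebraic_relCoreSteps hT₁ hCP H k K O))
    d

/-- **The split of the summit's `p`-component at generalised arcs.** Granted Temkin's
inseparable local uniformization in height one and Cossart–Piltant's resolution in dimension
`≤ 3`, resolution of singularities in characteristic `p` is EQUIVALENT to the conjunction of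
(global) two-model patching of proper models and (local) the core model-form `μ_p`-torsor steps
at the rank-one, residually algebraic valuation rings of finitely generated extensions, over all
fields of characteristic `p`. -/
theorem resolutionInChar_iff_twoModelPatching_and_zeroDimRankOneRelCoreSteps {p : ℕ}
    [Fact p.Prime] (hT₁ : Temkin2013HeightLeOne.{0}) (hCP : CossartPiltant2019LU3.{0}) :
    ResolutionInChar.{0} p ↔ ProperModel.TwoModelPatching.{0} p ∧
      (∀ (k K : Type) [Field k] [CharP k p] [Field K] [Algebra k K],
        (⊤ : IntermediateField k K).FG → ∀ O : ValuationSubring K,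
          Nonempty O.valuation.RankOne → (∀ c : k, algebraMap k K c ∈ O) →
            IsResiduallyAlgebraic k O → RelMuPTorsorCoreStepsAt p k O) :=
  ⟨fun h => ⟨ProperModel.twoModelPatching_of_resolutionInChar h,
      zeroDimRankOneRelCoreSteps_of_resolutionInChar h⟩,
    fun h => resolutionInChar_of_properTwoModelPatching_of_lu h.1
      (localUniformizationInChar_of_rankOne_residuallyAlgebraic_relCoreSteps hT₁ hCP h.2)⟩

/-- The same granted the full relative theorem `Temkin2013Relative` and the full
Cossart–Piltant theorem `CossartPiltant2019`. -/
theorem resolutionInChar_iff_twoModelPatching_and_zeroDimRankOneRelCoreSteps' {p : ℕ}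
    [Fact p.Prime] (hT : Temkin2013Relative.{0}) (hCP : CossartPiltant2019.{0}) :
    ResolutionInChar.{0} p ↔ ProperModel.TwoModelPatching.{0} p ∧
      (∀ (k K : Type) [Field k] [CharP k p] [Field K] [Algebra k K],
        (⊤ : IntermediateField k K).FG → ∀ O : ValuationSubring K,
          Nonempty O.valuation.RankOne → (∀ c : k, algebraMap k K c ∈ O) →
            IsResiduallyAlgebraic k O → RelMuPTorsorCoreStepsAt p k O) :=
  resolutionInChar_iff_twoModelPatching_and_zeroDimRankOneRelCoreSteps (hT.heightLE 1) hCP.lu3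

/-- **Exact local proxy at generalised arcs.** Granted Temkin (height one) and Cossart–Piltant
(dim ≤ 3): relative local uniformization in characteristic `p` (all ground fields) is
EQUIVALENT to the core model-form steps at rank-one residually algebraic valuation rings, and
resolution in characteristic `p` implies both. -/
theorem resolutionInChar_localProxy_zeroDimRankOne {p : ℕ} [Fact p.Prime]
    (hT₁ : Temkin2013HeightLeOne.{0}) (hCP : CossartPiltant2019LU3.{0}) :
    (ResolutionInChar.{0} p →
      ∀ (k K : Type) [Field k] [CharP k p] [Field K] [Algebra k K],
        (⊤ : IntermediateField k K).FG → ∀ O : ValuationSubring K,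
          Nonempty O.valuation.RankOne → (∀ c : k, algebraMap k K c ∈ O) →
            IsResiduallyAlgebraic k O → RelMuPTorsorCoreStepsAt p k O) ∧
      ((∀ (k K : Type) [Field k] [CharP k p] [Field K] [Algebra k K] (O : ValuationSubring K),
          (∀ c : k, algebraMap k K c ∈ O) → RelLocalUniformization k K O) ↔
        ∀ (k K : Type) [Field k] [CharP k p] [Field K] [Algebra k K],
          (⊤ : IntermediateField k K).FG → ∀ O : ValuationSubring K,
            Nonempty O.valuation.RankOne → (∀ c : k, algebraMap k K c ∈ O) →
              IsResiduallyAlgebraic k O → RelMuPTorsorCoreStepsAt p k O) :=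
  ⟨zeroDimRankOneRelCoreSteps_of_resolutionInChar,
    relLocalUniformization_iff_rankOne_residuallyAlgebraic_relCoreSteps hT₁ hCP⟩

/-- **The summit itself, split at generalised arcs.** Granted Temkin (height one) and
Cossart–Piltant (dim ≤ 3) in universe `0`: resolution of singularities in positive
characteristic (the summit statement, verbatim
`Literature.AlgebraicGeometry.Resolution.ResolutionOfSingularities`) is EQUIVALENT to: for every
prime `p`, two-model patching of proper models in characteristic `p` AND the core model-form
`μ_p`-torsor steps at the rank-one, residually algebraic valuation rings of finitely generated
extensions of fields of characteristic `p`. -/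
theorem resolutionOfSingularities_iff_twoModelPatching_and_zeroDimRankOneRelCoreSteps
    (hT₁ : Temkin2013HeightLeOne.{0}) (hCP : CossartPiltant2019LU3.{0}) :
    Literature.AlgebraicGeometry.Resolution.ResolutionOfSingularities ↔
      ∀ p : ℕ, p.Prime → ProperModel.TwoModelPatching.{0} p ∧
      (∀ (k K : Type) [Field k] [CharP k p] [Field K] [Algebra k K],
        (⊤ : IntermediateField k K).FG → ∀ O : ValuationSubring K,
          Nonempty O.valuation.RankOne → (∀ c : k, algebraMap k K c ∈ O) →
            IsResiduallyAlgebraic k O → RelMuPTorsorCoreStepsAt p k O) := by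
  refine forall_congr' fun p => forall_congr' fun hp => ?_
  haveI : Fact p.Prime := ⟨hp⟩
  exact resolutionInChar_iff_twoModelPatching_and_zeroDimRankOneRelCoreSteps hT₁ hCP

end Summit.ResolutionOfSingularities.ResolutionOfSingularities.Theorems

end
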